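import Literature.Barriers.CriticalPhenomena.WeaklySAWPerturbativeBeta
import Literature.Barriers.CriticalPhenomena.RigorousRGSmallParameterPerturbativeCoefficientsXi
import Literature.Barriers.CriticalPhenomena.WeaklySAWFlowStructuralStability
import HarnessLib

/-!
# BBS 2015, §6.1: the coefficients `θ_j, η_j, ξ_j, π_j` of the quadratic flow `φ̄` of the weakly
# self-avoiding walk ("defined precisely in [BBS-rg-pt]"), and `φ̄` as a `QuadFlowParams`

Companion of `WeaklySAWPerturbativeBeta.lean` (`β_j = 8Σ_x(w_{j+1,x}² - w_{j,x}²)`, `w_j = Σ_{i≤j}C_i`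
on the explicit decomposition `C_j = LongRangePhi4.FRD.Gam d L m² j`) and of
`WeaklySAWFlowStructuralStability.lean` (`QuadFlowParams`: the abstract quadratic flow of
[BBS-rg-flow] with its Assumptions (A1)–(A2), `HypA1`, `HypA2`). Sources: Bauerschmidt–Brydges–Slade,
CMP 337 (2015) [BBS2015], §6.1, display (6.x) of `φ̄_j`:
"`ḡ_{j+1} = ḡ_j - β_jḡ_j²`, `z̄_{j+1} = z̄_j - θ_jḡ_j²`,
`μ̄_{j+1} = L²μ̄_j(1 - γβ_jḡ_j) + η_jḡ_j - ξ_jḡ_j² - π_jḡ_jz̄_j`, where `β_j, θ_j, η_j, ξ_j, π_j` are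
real coefficients defined precisely in [BBS-rg-pt]" (`γ = ¼`), and "(where in the notation of
[BBS-rg-flow], `ζ_j = 0`, `υ_j^{gg} = ξ_j`, `υ_j^{gz} = π_j`, `υ_j^{gμ} = L²γβ_j`, and
`υ_j^{zz} = υ_j^{zμ} = 0`)"; and R. Bauerschmidt, D. C. Brydges, G. Slade, *A renormalisation group
method. III. Perturbative analysis*, J. Stat. Phys. **159** (2015), arXiv:1403.7252 [BBS-rg-pt],
§3.6 ("We write `C = C_{j+1}` and `w = w_j = Σ_{i=1}^jC_i`. … `η' = 2C_{0,0}`, `ν₊ = ν + η'g`,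
`w₊ = w + C` … `δ[f(ν,w)] = f(ν₊,w₊) - f(ν,w)` … `q^{(n)} = Σ_{x∈ℤ^d}q_{0,x}ⁿ`,
`q^{(**)} = Σ_{x∈ℤ^d}x₁²q_{0,x}`. All of the functions `q_{0,x}` that we use are combinations of `w`
that are invariant under lattice rotations, so that `x₁²` can be replaced by `x_i²` for any
`i = 1,…,d` … `β = 8δ[w^{(2)}]`, `θ = 2δ[(w³)^{(**)}]`, `ξ' = 4(δ[w^{(3)}] - 3w^{(2)}C_{0,0}) + ¼βη'`,
`π' = 2δ[(wΔw)^{(1)}]`") and §4.2 ("`μ_j = L^{2j}ν_j` … `ω_j = L²¼β_j`, `γ_j = L^{2(j+1)}γ'_j`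
(`γ = η, ξ, π`)"; the transformed flow (newflow-gbar)–(newflow-mubar):
"`μ̄_{j+1} = L²μ̄_j + η_jḡ_j - ξ_jḡ_j² - ω_jḡ_jμ̄_j - π_jḡ_jz̄_j`").

## What this file provides (definitions with bodies; everything else proved; no named fact)

* `starSum q` — `q^{(**)}`, in the rotation-averaged form `d⁻¹Σ_x|x|₂²q_x` (equal to the printed
  `Σ_xx₁²q_x` for the rotation-invariant `q` to which the source applies it, by the quoted remark);
  `lapl q` — the lattice Laplacian `(Δq)_x = Σ_{|e|=1}(q_{x+e} - q_x)`;
* `etaPrimePT`, `etaPT` (`η' = 2C_{j+1;0,0}`, `η_j = L^{2(j+1)}η'_j`); `thetaPT`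
  (`θ_j = 2δ[(w³)^{(**)}]`); `xiPrimePT`, `xiPT` (`ξ'`, `ξ_j = L^{2(j+1)}ξ'_j`); `piPrimePT`, `piPT`
  (`π' = 2δ[(wΔw)^{(1)}]`, `π_j = L^{2(j+1)}π'_j`); `omegaPT` (`ω_j = L²¼β_j`);
* finite-range reductions: `starSum_eq_sum`, `lapl_eq_zero_of_forall`, `lapl_covSum_eq_zero`,
  `tsum_mul_lapl_covSum_eq_sum` (all the sums over `ℤ^d` are finite sums over `ℓ¹`-balls);
* **`wsawQuadFlow L m²`** — `φ̄` of BBS2015 §6.1 as a `QuadFlowParams` (`λ_j = L²`, `γ_j = ζ_j =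
  υ^{zz} = υ^{zμ} = 0`, `υ^{gg} = ξ`, `υ^{gz} = π`, `υ^{gμ} = ω = L²¼β`), with `wsawQuadFlow_map_*`:
  its map IS the printed display (`μ̄ ↦ L²μ̄(1 - ¼β_jḡ) + η_jḡ - ξ_jḡ² - π_jḡz̄`).
-/

noncomputable section

open Set Filter Topology
open Literature.Probability.LatticeModels
open scoped BigOperators

namespace Literature.Barriers.CriticalPhenomena

namespace CTWSAW

open LongRangePhi4 LongRangePhi4.FRD PT

variable {d : ℕ}

/-! ### `q^{(**)}` and the lattice Laplacian -/

/-- **`q^{(**)}`**, rotation-averaged: `d⁻¹Σ_{x∈ℤ^d}|x|₂²q_{0,x}` (the source's `Σ_xx₁²q_{0,x}`; "`x₁²`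
can be replaced by `x_i²` for any `i`" for the rotation-invariant `q` used, so the two agree there).
[cite: BauerschmidtBrydgesSlade2015LogCorr, §6.1 (coefficients "defined precisely in [BBS-rg-pt]": [BBS-rg-pt] §3.6, display (wndef))] -/
def starSum (q : Site d → ℝ) : ℝ := (∑' x : Site d, (∑ i, ((x i : ℤ) : ℝ) ^ 2) * q x) / d

/-- **The lattice Laplacian** `(Δq)_x = Σ_{i=1}^d(q_{x+e_i} + q_{x-e_i} - 2q_x)`.
[cite: BauerschmidtBrydgesSlade2015LogCorr, §6.1 ([BBS-rg-pt] §3.6: π' = 2δ[(wΔw)^{(1)}], Δ = Δ_{ℤ^d})] -/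
def lapl (q : Site d → ℝ) (x : Site d) : ℝ :=
  ∑ i : Fin d, (q (x + Pi.single i 1) + q (x - Pi.single i 1) - 2 * q x)

/-! ### The coefficients -/

/-- **`η'_j = 2C_{j+1;0,0}`**. [cite: BauerschmidtBrydgesSlade2015LogCorr, §6.1 ([BBS-rg-pt] §3.6, (nuplusdef): η' = 2C_{0,0} with C = C_{j+1})] -/
def etaPrimePT (d : ℕ) (L s : ℝ) (j : ℕ) : ℝ := 2 * Gam d L s (j + 1) 0

/-- **`η_j = L^{2(j+1)}η'_j = 2L^{2(j+1)}C_{j+1;0,0}`**. [cite: BauerschmidtBrydgesSlade2015LogCorr, §8.5 (display η_j = 2L^{2(j+1)}C_{j+1;0,0}) and §6.1 ([BBS-rg-pt] §4.2: γ_j = L^{2(j+1)}γ'_j)] -/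
def etaPT (d : ℕ) (L s : ℝ) (j : ℕ) : ℝ := L ^ (2 * (j + 1)) * etaPrimePT d L s j

/-- **`θ_j = 2δ[(w³)^{(**)}] = 2((w_{j+1}³)^{(**)} - (w_j³)^{(**)})`**.
[cite: BauerschmidtBrydgesSlade2015LogCorr, §6.1 ([BBS-rg-pt] §3.6, (betadef): θ = 2δ[(w³)^{(**)}])] -/
def thetaPT (d : ℕ) (L s : ℝ) (j : ℕ) : ℝ :=
  2 * (starSum (fun x => covSum d L s (j + 1) x ^ 3) - starSum (fun x => covSum d L s j x ^ 3))

/-- **`ξ'_j = 4(δ[w^{(3)}] - 3w^{(2)}C_{0,0}) + ¼βη'`** (`w = w_j`, `C = C_{j+1}`, `β = β_j`).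
[cite: BauerschmidtBrydgesSlade2015LogCorr, §6.1 ([BBS-rg-pt] §3.6, (xipidef))] -/
def xiPrimePT (d : ℕ) (L s : ℝ) (j : ℕ) : ℝ :=
  4 * ((powSum (covSum d L s (j + 1)) 3 - powSum (covSum d L s j) 3) -
      3 * powSum (covSum d L s j) 2 * Gam d L s (j + 1) 0) +
    1 / 4 * betaPT d L s j * etaPrimePT d L s j

/-- **`ξ_j = L^{2(j+1)}ξ'_j`**. [cite: BauerschmidtBrydgesSlade2015LogCorr, §6.1 ([BBS-rg-pt] §4.2: γ_j = L^{2(j+1)}γ'_j, γ = ξ)] -/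
def xiPT (d : ℕ) (L s : ℝ) (j : ℕ) : ℝ := L ^ (2 * (j + 1)) * xiPrimePT d L s j

/-- **`π'_j = 2δ[(wΔw)^{(1)}] = 2(Σ_xw_{j+1,x}(Δw_{j+1})_x - Σ_xw_{j,x}(Δw_j)_x)`**.
[cite: BauerschmidtBrydgesSlade2015LogCorr, §6.1 ([BBS-rg-pt] §3.6, (xipidef): π' = 2δ[(wΔw)^{(1)}])] -/
def piPrimePT (d : ℕ) (L s : ℝ) (j : ℕ) : ℝ :=
  2 * ((∑' x : Site d, covSum d L s (j + 1) x * lapl (covSum d L s (j + 1)) x) -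
    ∑' x : Site d, covSum d L s j x * lapl (covSum d L s j) x)

/-- **`π_j = L^{2(j+1)}π'_j`**. [cite: BauerschmidtBrydgesSlade2015LogCorr, §6.1 ([BBS-rg-pt] §4.2: γ_j = L^{2(j+1)}γ'_j, γ = π)] -/
def piPT (d : ℕ) (L s : ℝ) (j : ℕ) : ℝ := L ^ (2 * (j + 1)) * piPrimePT d L s j

/-- **`ω_j = L²¼β_j`** (`= υ_j^{gμ} = L²γβ_j`, `γ = ¼`). [cite: BauerschmidtBrydgesSlade2015LogCorr, §6.1 (υ_j^{gμ} = L²γβ_j; [BBS-rg-pt] §4.2: ω_j = L²¼β_j)] -/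
def omegaPT (d : ℕ) (L s : ℝ) (j : ℕ) : ℝ := L ^ 2 * (1 / 4) * betaPT d L s j

/-! ### Finite-range reductions -/

/-- `q^{(**)}` is a finite sum over any finite set containing the support of `q`. [folklore] -/
theorem starSum_eq_sum {q : Site d → ℝ} {S : Finset (Site d)} (hq : ∀ x ∉ S, q x = 0) :
    starSum q = (∑ x ∈ S, (∑ i, ((x i : ℤ) : ℝ) ^ 2) * q x) / d := by
  unfold starSum
  rw [tsum_eq_sum fun x hx => by rw [hq x hx, mul_zero]]

/-- `ℓ¹`-norm of a unit step. [folklore] -/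
theorem sum_natAbs_single (i : Fin d) (a : ℤ) :
    (∑ k, ((Pi.single i a : Site d) k).natAbs) = a.natAbs := by
  rw [Finset.sum_eq_single i]
  · simp
  · intro k _ hk; simp [Pi.single_eq_of_ne hk]
  · intro h; exact absurd (Finset.mem_univ i) h

/-- `|x ± e_i|₁ ≥ |x|₁ - 1`. [folklore] -/
theorem sum_natAbs_add_single_ge (x : Site d) (i : Fin d) (a : ℤ) (ha : a.natAbs = 1) :
    (∑ k, (x k).natAbs) ≤ (∑ k, ((x + (Pi.single i a : Site d)) k).natAbs) + 1 := by
  set e : Site d := Pi.single i a with he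
  have h1 : (∑ k, (x k).natAbs) ≤ (∑ k, ((x + e) k).natAbs) + ∑ k, (e k).natAbs := by
    rw [← Finset.sum_add_distrib]
    refine Finset.sum_le_sum fun k _ => ?_
    have : x k = (x + e) k - e k := by simp
    calc (x k).natAbs = ((x + e) k - e k).natAbs := by rw [← this]
      _ ≤ ((x + e) k).natAbs + (e k).natAbs := Int.natAbs_sub_le _ _
  rwa [he, sum_natAbs_single, ha] at h1

/-- The Laplacian of a function vanishing on `|x|₁ ≥ R` vanishes on `|x|₁ ≥ R + 1`. [folklore] -/
theorem lapl_eq_zero_of_forall {q : Site d → ℝ} {R : ℝ}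
    (hq : ∀ x : Site d, R ≤ ((∑ k, (x k).natAbs : ℕ) : ℝ) → q x = 0) {x : Site d}
    (hx : R + 1 ≤ ((∑ k, (x k).natAbs : ℕ) : ℝ)) : lapl q x = 0 := by
  unfold lapl
  refine Finset.sum_eq_zero fun i _ => ?_
  have h0 : q x = 0 := hq x (by linarith)
  have hp : q (x + Pi.single i 1) = 0 := by
    refine hq _ ?_
    have := sum_natAbs_add_single_ge x i 1 (by simp)
    have : ((∑ k, (x k).natAbs : ℕ) : ℝ) ≤
        ((∑ k, ((x + (Pi.single i 1 : Site d)) k).natAbs : ℕ) : ℝ) + 1 := by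
      exact_mod_cast this
    linarith
  have hm : q (x - Pi.single i 1) = 0 := by
    refine hq _ ?_
    have := sum_natAbs_add_single_ge x i (-1) (by simp)
    have e : x + (Pi.single i (-1) : Site d) = x - Pi.single i 1 := by
      ext k; by_cases hk : k = i
      · subst hk; simp [sub_eq_add_neg]
      · simp [Pi.single_eq_of_ne hk]
    rw [e] at this
    have : ((∑ k, (x k).natAbs : ℕ) : ℝ) ≤
        ((∑ k, ((x - (Pi.single i 1 : Site d)) k).natAbs : ℕ) : ℝ) + 1 := by
      exact_mod_cast this
    linarith
  rw [h0, hp, hm]; ring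

/-- `(Δw_j)_x = 0` for `|x|₁ ≥ ½L^j + 1` (`d ≥ 1`, `L ≥ 1`, `m² ≥ 0`). [cite: BauerschmidtBrydgesSlade2015LogCorr, §5.1 (finite range)] -/
theorem lapl_covSum_eq_zero (hd : 1 ≤ d) {L : ℝ} (hL : 1 ≤ L) {s : ℝ} (hs : 0 ≤ s) (j : ℕ) {x : Site d}
    (hx : L ^ j / 2 + 1 ≤ ((∑ k, (x k).natAbs : ℕ) : ℝ)) : lapl (covSum d L s j) x = 0 :=
  lapl_eq_zero_of_forall (fun _ hy => covSum_eq_zero hd hL hs hy) hx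

/-- `Σ_xw_{j,x}(Δw_j)_x` is a finite sum over the ball `|x|₁ < ½L^j`. [cite: BauerschmidtBrydgesSlade2015LogCorr, §5.1 (finite range)] -/
theorem tsum_mul_lapl_covSum_eq_sum (hd : 1 ≤ d) {L : ℝ} (hL : 1 ≤ L) {s : ℝ} (hs : 0 ≤ s) (j : ℕ) :
    ∑' x : Site d, covSum d L s j x * lapl (covSum d L s j) x =
      ∑ x ∈ PT.ball (L ^ j / 2), covSum d L s j x * lapl (covSum d L s j) x := by
  refine tsum_eq_sum fun x hx => ?_
  rw [PT.mem_ball, not_lt] at hx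
  rw [covSum_eq_zero hd hL hs hx, zero_mul]

/-- `(w_j³)^{(**)}` is a finite sum over the ball `|x|₁ < ½L^j`. [cite: BauerschmidtBrydgesSlade2015LogCorr, §5.1 (finite range)] -/
theorem starSum_covSum_pow_eq_sum (hd : 1 ≤ d) {L : ℝ} (hL : 1 ≤ L) {s : ℝ} (hs : 0 ≤ s) (j : ℕ)
    {n : ℕ} (hn : n ≠ 0) :
    starSum (fun x => covSum d L s j x ^ n) =
      (∑ x ∈ PT.ball (L ^ j / 2), (∑ i, ((x i : ℤ) : ℝ) ^ 2) * covSum d L s j x ^ n) / d := by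
  refine starSum_eq_sum fun x hx => ?_
  rw [PT.mem_ball, not_lt] at hx
  rw [covSum_eq_zero hd hL hs hx, zero_pow hn]

/-! ### `φ̄` of the weakly self-avoiding walk as a `QuadFlowParams` -/

/-- **The quadratic flow `φ̄` of BBS 2015, §6.1** (explicit decomposition, mass `m²`, `d = 4`) in
the format of [BBS-rg-flow]: `λ_j = L²`, `η_j`, `β_j`, `θ_j` as defined, `γ_j = ζ_j = 0`,
`υ^{gg}_j = ξ_j`, `υ^{gz}_j = π_j`, `υ^{gμ}_j = ω_j = L²¼β_j`, `υ^{zz}_j = υ^{zμ}_j = 0`.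
[cite: BauerschmidtBrydgesSlade2015LogCorr, §6.1 (display of φ̄_j; "in the notation of [BBS-rg-flow], ζ_j = 0, υ_j^{gg} = ξ_j, υ_j^{gz} = π_j, υ_j^{gμ} = L²γβ_j, and υ_j^{zz} = υ_j^{zμ} = 0")] -/
def wsawQuadFlow (L s : ℝ) : QuadFlowParams where
  η := etaPT 4 L s
  γ := fun _ => 0
  lam := fun _ => L ^ 2
  β := betaPT 4 L s
  θ := thetaPT 4 L s
  ζ := fun _ => 0
  υgg := xiPT 4 L s
  υgz := piPT 4 L s
  υgμ := omegaPT 4 L s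
  υzz := fun _ => 0
  υzμ := fun _ => 0

/-- The `ḡ`-row of `φ̄_j`: `ḡ_{j+1} = ḡ_j - β_jḡ_j²`. [cite: BauerschmidtBrydgesSlade2015LogCorr, §6.1 (display of φ̄_j, first row)] -/
theorem wsawQuadFlow_map_zero (L s : ℝ) (j : ℕ) (V : V3) :
    (wsawQuadFlow L s).map j V 0 = V 0 - betaPT 4 L s j * V 0 ^ 2 := rfl

/-- The `z̄`-row of `φ̄_j`: `z̄_{j+1} = z̄_j - θ_jḡ_j²`. [cite: BauerschmidtBrydgesSlade2015LogCorr, §6.1 (display of φ̄_j, second row)] -/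
theorem wsawQuadFlow_map_one (L s : ℝ) (j : ℕ) (V : V3) :
    (wsawQuadFlow L s).map j V 1 = V 1 - thetaPT 4 L s j * V 0 ^ 2 := by
  simp [wsawQuadFlow]

/-- The `μ̄`-row of `φ̄_j` IS the printed one:
`μ̄_{j+1} = L²μ̄_j(1 - ¼β_jḡ_j) + η_jḡ_j - ξ_jḡ_j² - π_jḡ_jz̄_j` (`γ = ¼`).
[cite: BauerschmidtBrydgesSlade2015LogCorr, §6.1 (display of φ̄_j, third row, γ = ¼)] -/
theorem wsawQuadFlow_map_two (L s : ℝ) (j : ℕ) (V : V3) :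
    (wsawQuadFlow L s).map j V 2 =
      L ^ 2 * V 2 * (1 - 1 / 4 * betaPT 4 L s j * V 0) + etaPT 4 L s j * V 0 -
        xiPT 4 L s j * V 0 ^ 2 - piPT 4 L s j * V 0 * V 1 := by
  simp only [QuadFlowParams.map_apply_two, wsawQuadFlow, omegaPT]
  ring

end CTWSAW

end Literature.Barriers.CriticalPhenomena
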